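import Summits.AtomisticToContinuum.HydrodynamicLimit.Theses.LindebergRandomFuture
import Summits.AtomisticToContinuum.HydrodynamicLimit.Theorems.LambertianContactSwapLambertianEulerOfHearts
import Summits.AtomisticToContinuum.HydrodynamicLimit.Theses.LambertianContactSwap
import Summits.AtomisticToContinuum.HydrodynamicLimit.Theorems.LambertianContactSwapLambertianEulerArchimedes
import Summits.AtomisticToContinuum.HydrodynamicLimit.Theorems.LambertianContactSwapLambertianEulerLambertLaw
import Summits.AtomisticToContinuum.HydrodynamicLimit.Theorems.LambertianContactSwapLambertianEulerPovzner
import Summits.AtomisticToContinuum.HydrodynamicLimit.Theorems.LambertianContactSwapLambertianEulerPairPovzner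
import Summits.AtomisticToContinuum.HydrodynamicLimit.Theorems.LambertianContactSwapLambertianEulerContactIsotropy
import Summits.AtomisticToContinuum.HydrodynamicLimit.Theorems.LambertianContactSwapLambertianEulerMomentLedgerChain
import Summits.AtomisticToContinuum.HydrodynamicLimit.Theorems.LambertianContactSwapLambertianEulerGibbsInvariance
import Summits.AtomisticToContinuum.HydrodynamicLimit.Theorems.LambertianContactSwapLambertianEulerEntropyToHydro
import Summits.AtomisticToContinuum.HydrodynamicLimit.Theorems.LambertianContactSwapLambertianEulerWindow
import Summits.AtomisticToContinuum.HydrodynamicLimit.Theorems.LambertianContactSwapLambertianEulerMarkov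
import Summits.AtomisticToContinuum.HydrodynamicLimit.Theorems.LambertianContactSwapLambertianEulerIterate
import Summits.AtomisticToContinuum.HydrodynamicLimit.Theorems.LambertianContactSwapLambertianEulerDock
import Summits.AtomisticToContinuum.HydrodynamicLimit.Theorems.LambertianContactSwapLambertianEulerKlLedger
import Summits.AtomisticToContinuum.HydrodynamicLimit.Theorems.LambertianContactSwapLambertianEulerLawSemigroup
import Summits.AtomisticToContinuum.HydrodynamicLimit.Theorems.LambertianContactSwapLambertianEulerDockRf
import Summits.AtomisticToContinuum.HydrodynamicLimit.Theorems.LambertianContactSwapLambertianEulerLambertDirMean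
import Summits.AtomisticToContinuum.HydrodynamicLimit.Theorems.LambertianContactSwapLambertianEulerPairMeanSq
import Summits.AtomisticToContinuum.HydrodynamicLimit.Theorems.LambertianContactSwapLambertianEulerPathwiseProduction
import Summits.AtomisticToContinuum.HydrodynamicLimit.Theorems.LambertianContactSwapLambertianEulerWindowLedger
import Summits.AtomisticToContinuum.HydrodynamicLimit.Theorems.LambertianContactSwapLambertianEulerCollisionCompensator
import Summits.AtomisticToContinuum.HydrodynamicLimit.Theorems.LambertianContactSwapLambertianEulerCompensatedJump
import Summits.AtomisticToContinuum.HydrodynamicLimit.Theorems.LambertianContactSwapLambertianEulerAprioriEntropyBound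
import Summits.AtomisticToContinuum.HydrodynamicLimit.Theorems.LambertianContactSwapLambertianEulerCollisionIntensity
import Summits.AtomisticToContinuum.HydrodynamicLimit.Theorems.LambertianContactSwapLambertianEulerTwoTimeLaw
import Summits.AtomisticToContinuum.HydrodynamicLimit.Theorems.LambertianContactSwapLambertianEulerCollisionBudget
import Summits.AtomisticToContinuum.HydrodynamicLimit.Theorems.LambertianContactSwapLambertianEulerExpectedWindowProductionTools
import Summits.AtomisticToContinuum.HydrodynamicLimit.Theorems.LambertianContactSwapLambertianEulerExpectedWindowProduction
import Summits.AtomisticToContinuum.HydrodynamicLimit.Theorems.LambertianContactSwapLambertianEulerProductionSplit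
import Summits.AtomisticToContinuum.HydrodynamicLimit.Theorems.TwoClocksClampedEntropyClockTimeZeroReference
import Summits.AtomisticToContinuum.HydrodynamicLimit.Theorems.TwoClocksClampedEntropyClockDiscreteEntropyGronwall
import Summits.AtomisticToContinuum.HydrodynamicLimit.Theorems.TwoClocksClampedEntropyClockKlDivLawAtLocalGibbsNeTop
import Literature.MathematicalPhysics.KineticTheory.LambertianRedrawNondegenerate
import Literature.MathematicalPhysics.KineticTheory.Hilbert6Wave0Proofs
import Literature.MathematicalPhysics.KineticTheory.HardSphereEulerLLN
import Literature.Barriers.AtomisticToContinuum.HighMomentumCutoff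
import Literature.Analysis.FluidPDE.HardSphereAlexander
import Summits.AtomisticToContinuum.HydrodynamicLimit.Theorems.ImplosionDichotomyDenseExcursionR2ExteriorDevelopment
import Summits.AtomisticToContinuum.HydrodynamicLimit.Theorems.ImplosionDichotomyPolynomialCompressionStaticsLLN
import Summits.AtomisticToContinuum.HydrodynamicLimit.Theorems.ImplosionDichotomyPolynomialCompressionStaticsSmoothRate
import Summits.AtomisticToContinuum.HydrodynamicLimit.Theorems.PolynomialCompression.Negative.PdeForm
import HarnessLib

/-! TTRL-lite variant V13062 of stmt-AtomisticToContinuum-11854 -/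

namespace Summit.AtomisticToContinuum.HydrodynamicLimit.Theorems

open scoped BigOperators Topology ENNReal InnerProductSpace
open MeasureTheory ProbabilityTheory Filter Set InformationTheory
open Literature.MathematicalPhysics.KineticTheory
open Literature.Analysis.FluidPDE Literature.Analysis.FluidPDE.Alexander
open Summit.AtomisticToContinuum.HydrodynamicLimit.Theses.LambertianContactSwap
open Summit.AtomisticToContinuum.HydrodynamicLimit.Theorems.ClampedCurrentsDockPathwise (gSum DgSum)

/-- **Case-I dilute self-consistency in the isentropic class** (TTRL-lite variant V13062 of
`stub_diluteSelfConsistency`, stmt-AtomisticToContinuum-11854). If the ideal (`σ = 0`) isentropic development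
`(ρ₁, u₁, θ₁ = K ρ₁^{2/3})` of the data `(a₀/∫a₀, u₀, K (a₀/∫a₀)^{2/3})` is classical on `[0, T₂)` with
`T₁ < T₂`, then below some `σ₀ > 0` every classical hard-sphere Euler solution tied at `t = 0` to the local
Gibbs laws of the profiles `(a₀, u₀, K (a₀/∫a₀)^{2/3})` (through one flow family) has packing fraction
`ρ σ³ < η` on `[0, min T T₁)`. Pure glue over landed machinery: the tie pins the data to
`(rhoLim (profileOf a₀) σ, u₀, θ₀)` (`tendstoHydroFieldsAt_zero_iff_flowFree`, `data_eq_of_flowFree`,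
`stub_staticsLLN`), the statics are `σ³`-close to `a₀/∫a₀` in every `Cⁿ` (`stub_staticsSmoothRate`), the
reference restricted to the compact sub-horizon `T₃ := (T₁ + T₂)/2` has trivial Type-I / polynomial / floor
clauses (`typeI_of_lt`, `poly_of_lt`, `floor_of_lt`), and the polynomial-loss shadowing a-priori estimate
`stub_logBudgetShadowing` at packing target `η/2` bounds every solution with the pinned data on horizons
`≤ T₃ − σ^e/2 ≥ T₁` (`exists_rpow_half_le`), applied to the solution restricted to `min T (T₃ − σ^e/2)`
(`isHardSphereEulerSolution_restrict`). -/
theorem stub_diluteSelfConsistency_var13062 : ∀ η : ℝ, 0 < η → ∀ (a₀ : T3 → ℝ) (u₀ : T3 → V3) (K : ℝ), Literature.Analysis.FunctionSpaces.Torus.IsSmooth a₀ → Literature.Analysis.FunctionSpaces.Torus.IsSmooth u₀ → (∀ x, 0 < a₀ x) → 0 < K → ∀ (T₁ T₂ : ℝ) (ρ₁ θ₁ : ℝ → T3 → ℝ) (u₁ : ℝ → T3 → V3), T₁ < T₂ → IsHardSphereEulerSolution 0 T₂ ρ₁ u₁ θ₁ → (∀ x, ρ₁ 0 x = a₀ x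 / ∫ y, a₀ y) → u₁ 0 = u₀ → (∀ t ∈ Set.Ico 0 T₂, ∀ x, θ₁ t x = K * ρ₁ t x ^ (2 / 3 : ℝ)) → ∃ σ₀ : ℝ, 0 < σ₀ ∧ ∀ σ : ℝ, 0 < σ → σ < σ₀ → ∀ (T : ℝ) (ρ θ : ℝ → T3 → ℝ) (u : ℝ → T3 → V3), IsHardSphereEulerSolution σ T ρ u θ → ∀ Φ : (N : ℕ) → HardSphereFlow (Torus.geometry (Fin 3)) (hsDiameter σ N) (N + 1), TendstoHydroFieldsAt (fun N => localGibbsLaw σ a₀ u₀ (fun x => K * (a₀ x / ∫ y, a₀ y) ^ (2 / 3 : ℝ)) N (Φ N)) Φ ρ u θ 0 → ∀ t ∈ Set.Ico 0 (min T T₁), ∀ x, ρ t x * σ ^ 3 < η := by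
  intro η hη a₀ u₀ K ha hu ha0 hK T₁ T₂ ρ₁ θ₁ u₁ hT₁₂ hE₁ hρ₁0 hu₁0 hisen
  rcases le_or_gt T₁ 0 with hT₁ | hT₁
  · -- degenerate horizon: `Ico 0 (min T T₁)` is empty
    refine ⟨1, one_pos, fun σ _ _ T ρ θ u _ Φ _ t ht x => ?_⟩
    exact absurd ((ht.2.trans_le (min_le_right _ _)).trans_le hT₁) (not_lt.2 ht.1)
  · -- the temperature profile and the data of the reference at `t = 0`
    have hT₂ : 0 < T₂ := hT₁.trans hT₁₂
    have h0 : (0 : ℝ) ∈ Ico 0 T₂ := ⟨le_rfl, hT₂⟩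
    have hθ₁0 : θ₁ 0 = fun x => K * (a₀ x / ∫ y, a₀ y) ^ (2 / 3 : ℝ) := by
      funext x
      rw [hisen 0 h0 x, hρ₁0 x]
    have hθc : Continuous fun x => K * (a₀ x / ∫ y, a₀ y) ^ (2 / 3 : ℝ) := by
      rw [← hθ₁0]
      exact (hE₁.smooth_temperature.isSmooth_slice h0).continuous
    have hθ0 : ∀ x, 0 < (fun x => K * (a₀ x / ∫ y, a₀ y) ^ (2 / 3 : ℝ)) x := by
      rw [← hθ₁0]
      exact hE₁.temperature_pos 0 h0
    -- quantitative statics of the local Gibbs laws (identified LLN + `Cⁿ` rate)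
    obtain ⟨σ₁, hσ₁, Hst⟩ :=
      stub_staticsLLN a₀ (fun x => K * (a₀ x / ∫ y, a₀ y) ^ (2 / 3 : ℝ)) u₀ ha.continuous hθc hu.continuous
        ha0 hθ0
    obtain ⟨hsmooth, hrate⟩ := stub_staticsSmoothRate a₀ ha ha0
    have hρs : ∀ σ : ℝ, 0 < σ → σ < σ₁ →
        Literature.Analysis.FunctionSpaces.Torus.IsSmooth (rhoLim (profileOf a₀ ha.continuous ha0) σ) ∧
          ∀ x, 0 < rhoLim (profileOf a₀ ha.continuous ha0) σ x :=
      fun σ hσ hσ' => ⟨hsmooth σ (Hst σ hσ hσ').1, (Hst σ hσ hσ').2.1⟩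
    have hstat : ∀ n : ℕ, ∃ Cn : ℝ, ∀ σ : ℝ, 0 < σ → σ < σ₁ → ∀ y : EuclideanSpace ℝ (Fin 3),
        ‖iteratedFDeriv ℝ n (Literature.Analysis.FunctionSpaces.Torus.lift
            (fun x => rhoLim (profileOf a₀ ha.continuous ha0) σ x - a₀ x / ∫ z, a₀ z)) y‖ ≤ Cn * σ ^ 3 := by
      intro n
      obtain ⟨Cn, hCn⟩ := hrate n
      exact ⟨Cn, fun σ hσ hσ' y => hCn σ (Hst σ hσ hσ').1 y⟩
    -- the equation of state (route support, proved)
    obtain ⟨η₀, hη₀, F, hF, hEq, hF0, hF', -⟩ := hsEosLowDensity_proof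
    -- the compact sub-horizon `T₃ := (T₁ + T₂)/2` and the restricted reference
    obtain ⟨T₃, hT₃⟩ : ∃ T₃ : ℝ, T₃ = (T₁ + T₂) / 2 := ⟨_, rfl⟩
    have hT₃0 : 0 < T₃ := by rw [hT₃]; linarith
    have hT₃₂ : T₃ < T₂ := by rw [hT₃]; linarith
    have hT₁₃ : T₁ < T₃ := by rw [hT₃]; linarith
    have hE₃ : IsHardSphereEulerSolution 0 T₃ ρ₁ u₁ θ₁ := isHardSphereEulerSolution_restrict hE₁ hT₃₂.le
    have hisen₃ : ∀ t ∈ Ico 0 T₃, ∀ x, θ₁ t x = K * ρ₁ t x ^ (2 / 3 : ℝ) :=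
      fun t ht x => hisen t ⟨ht.1, ht.2.trans hT₃₂⟩ x
    -- the a-priori shadowing bounds on horizons `≤ T₃ - σ^e/2`, at the packing target `η/2`
    obtain ⟨e, he, σ₂, hσ₂, hσ₂₁, Hap⟩ :=
      stub_logBudgetShadowing η₀ hη₀ F hF hEq hF0 hF' (fun x => a₀ x / ∫ y, a₀ y)
        (fun x => K * (a₀ x / ∫ y, a₀ y) ^ (2 / 3 : ℝ)) u₀ T₃ K ρ₁ θ₁ u₁ hT₃0 hK hE₃ hρ₁0 hu₁0 hθ₁0
        hisen₃ (R2OneModeTwoConditions.ExteriorDevelopmentProof.typeI_of_lt hE₁ hT₃₂)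
        (R2OneModeTwoConditions.ExteriorDevelopmentProof.poly_of_lt hE₁ hT₃₂)
        (R2OneModeTwoConditions.ExteriorDevelopmentProof.floor_of_lt hE₁ hT₃0.le hT₃₂)
        (fun σ => rhoLim (profileOf a₀ ha.continuous ha0) σ) σ₁ hσ₁ hρs hstat (η / 2) (half_pos hη)
    -- smallness of the exit margin `σ^e/2` against `T₃ - T₁`
    obtain ⟨σ₃, hσ₃, hsmall⟩ :=
      R2OneModeTwoConditions.ExteriorDevelopmentProof.exists_rpow_half_le he (sub_pos.2 hT₁₃)
    refine ⟨min (min σ₂ σ₃) (1 / 2), lt_min (lt_min hσ₂ hσ₃) one_half_pos,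
      fun σ hσ hσlt T ρ θ u hE Φ htie t ht x => ?_⟩
    have hσσ₂ : σ < σ₂ := hσlt.trans_le ((min_le_left _ _).trans (min_le_left _ _))
    have hσσ₃ : σ < σ₃ := hσlt.trans_le ((min_le_left _ _).trans (min_le_right _ _))
    have hσ2 : σ ≤ 1 / 2 := (hσlt.trans_le (min_le_right _ _)).le
    have hσσ₁ : σ < σ₁ := hσσ₂.trans_le hσ₂₁
    -- the horizon of the solution is positive
    have htT : t < T := ht.2.trans_le (min_le_left _ _)
    have htT₁ : t < T₁ := ht.2.trans_le (min_le_right _ _)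
    have hTpos : 0 < T := ht.1.trans_lt htT
    -- pin the data: `ρ 0 = rhoLim`, `u 0 = u₀`, `θ 0 = θ₀`
    obtain ⟨hsd, hpos, hLLN⟩ := Hst σ hσ hσσ₁
    obtain ⟨hρc, huc, hθc'⟩ := PolynomialCompressionPDE.continuous_slices_zero hE hTpos
    have hlln := (PolynomialCompressionPDE.tendstoHydroFieldsAt_zero_iff_flowFree Φ).1 (hLLN Φ)
    have hff := (PolynomialCompressionPDE.tendstoHydroFieldsAt_zero_iff_flowFree Φ).1 htie
    obtain ⟨hρ0, hu0, hθ0'⟩ :=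
      PolynomialCompressionPDE.data_eq_of_flowFree ha.continuous hθc hu.continuous ha0 hθ0 hσ2
        hsd.continuous_rhoLim hpos hlln hρc huc hθc' hff
    -- the a-priori bounds for the solution restricted to `min T (T₃ - σ^e/2)`
    obtain ⟨-, -, M, -, Hbnd⟩ := Hap σ hσ hσσ₂
    have hT₁le : T₁ ≤ T₃ - σ ^ e / 2 := by linarith [hsmall σ hσ hσσ₃]
    have hE' : IsHardSphereEulerSolution σ (min T (T₃ - σ ^ e / 2)) ρ u θ :=
      isHardSphereEulerSolution_restrict hE (min_le_left _ _)
    have ht' : t ∈ Ico 0 (min T (T₃ - σ ^ e / 2)) := ⟨ht.1, lt_min htT (htT₁.trans_le hT₁le)⟩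
    have hb := (Hbnd (min T (T₃ - σ ^ e / 2)) (min_le_right _ _) ρ θ u hE' hρ0 hu0 hθ0' t ht' x).1
    linarith [hb.2.2.2.2.2.1]

end Summit.AtomisticToContinuum.HydrodynamicLimit.Theorems
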